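import Mathlib
import Summits.Schanuel.Schanuel.Theses.RigidCore
import Summits.Schanuel.Schanuel.Theorems.AclSubsetLogFreeCore.Negative.LogFreeCoreCountable
import Literature.Barriers.Schanuel.AlgebraicIndependenceOfLogarithms
import Literature.Barriers.Schanuel.LargeTranscendenceDegreeSmallTrdegProofs
import Literature.Barriers.Schanuel.LargeTranscendenceDegreeConjectureProofs
import Literature.NumberTheory.Transcendental.SchanuelSectorSplit
import Literature.NumberTheory.Transcendental.SchanuelEclEmptyProofs
import Literature.NumberTheory.Transcendental.OneMotiveToricProofs

/-!
# Line `kernel-tower-relative-lw` (route `RigidCore`): the kernel-tower reduction of the crux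

Support file for crux `stmt-Schanuel-0970`
(`Summit.Schanuel.Schanuel.Theses.RigidCore.SchanuelOnLogFreeCore`, "(R)": Schanuel's statement for
`ℚ`-linearly independent tuples from the log-free core `C_EA = logFreeCore`). It lands the
sorry-free GLUE of the line's skeleton (`Cruxes/SchanuelOnLogFreeCore/Lines/kernel_tower_relative_lw.lean`)
as tree theorems, over the tree's kernel tower `stage` (`stage 0 = ℚ(2πi)^{ralg}`,
`stage (m+1) = ℚ(stage m ∪ exp (stage m))^{ralg}`, file
`Theorems/AclSubsetLogFreeCore/Negative/LogFreeCoreObjects.lean`; `C_EA = ⋃ₘ stage m` is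
`mem_logFreeCore_iff_exists_stage`):

* `KernelTower.sectorSplit` — Kirby's `GL_n(ℚ)` bookkeeping in RELATIVE Lindemann–Weierstrass form:
  for `S ⊆ L` with `e^{span S} ⊆ L`, Schanuel on `span_ℚ S` ("inside") and algebraic independence
  OVER `L` of the exponentials of tuples from `L` independent modulo `span_ℚ S` ("outside") give
  Schanuel's statement for all tuples from `L` (adapted basis, cleared denominators, tower law);
* `KernelTower.insideKernelLine` — the base case at the kernel line `ℚ·2πi` (`trdeg = 1`, Lindemann);
* `KernelTower.schanuelOn_stage`, `stub_towerReduction` — **RelLW₀ ∧ (∀ m, RelLW_{m+1}) ⟹ (R)**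
  (registered on stmt-Schanuel-0970 as stub `stub_towerReduction`),
  the `⇐` half of the line's normal form; the `⇒` halves are the landed
  `stub_relLWZero_of_crux` (`…RelLWZeroOfCrux.lean`) and `stub_relLWStep_of_crux`
  (`…RelLWStepOfCrux.lean`), so `(R) ⟺ RelLW₀ ∧ ∀ m RelLW_{m+1}` (the `↔` is assembled in the
  skeleton as `relLW_exact`; it is not restated here to keep this file independent of modules the
  farm has not built yet);
* `KernelTower.schanuelOnStageZero_of_relLWZero` — level 0 isolated: `RelLW₀ ⟹` Schanuel for tuples
  from `L₀ = stage 0`; with the landed converse `stub_relLWZero_of_schanuelOnStageZero`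
  (`…RelLWZeroOfStageZero.lean`): `RelLW₀ ⟺ SC|_{L₀}` = "Schanuel's conjecture for numbers algebraic
  over `ℚ(π)`", the first open layer of the crux;
* `KernelTower.relLWZero_one_iff` — the `r = 1` layer three ways (`a ∈ L₀`, `e^a ∈ L₀ ⇒ a ∈ ℚ·2πi`).

Here `RelLW₀` := "for `u ⊂ stage 0` `ℚ`-independent modulo `ℚ·2πi`, `(e^{u i})` is algebraically
independent over `stage 0`" and `RelLW_{m+1}` := the same one level up (modulo `stage m`, over
`stage (m+1)`); both are OPEN (RelLW₀ ⊇ `e ⊥ π`) and appear only as HYPOTHESES.  Sources: J. Kirby,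
*Finitely presented exponential fields*, arXiv:0912.4019, Construction 2.9 (the e/a-chain) and
*Exponential algebraicity in exponential fields*, Bull. LMS 42 (2010), arXiv:0810.4285, Prop. 7.2
(the sector bookkeeping, tree `schanuel_of_sector_split_set`).  NOT here: any claim on RelLW₀ or
RelLW_{m+1} themselves; the Hankel calibration (landed, `…PiPowersTH.lean`).
-/

noncomputable section

open IntermediateField Complex
open Summit.Schanuel.Schanuel.Theorems.AclSubsetLogFreeCore.Negative
  (coreFamily logFreeCore relAlg mem_relAlg_iff le_relAlg relAlg_closed stage stage_le_succ
    monotone_stage exp_mem_stage_succ stage_closed two_pi_I_mem_stage_zero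
    mem_logFreeCore_iff_exists_stage stage_le_of_mem logFreeCore_mem_coreFamily)
open Literature.NumberTheory.Transcendental (transcendental_two_pi_I)

namespace Summit.Schanuel.Schanuel.Theorems.RigidCore

namespace KernelTower


/-! ## Glue, part 1: the tower (tree objects `stage`, `relAlg`) -/

/-- Algebraic numbers lie in every relative algebraic closure `relAlg K`. [folklore] -/
theorem mem_relAlg_of_isAlgebraic (K : IntermediateField ℚ ℂ) {a : ℂ}
    (ha : IsAlgebraic ℚ a) : a ∈ relAlg K :=
  mem_relAlg_iff.mpr (IsAlgebraic.tower_top (L := ↥K) ha)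

/-- `2πi ∈ L₀`. [folklore] -/
theorem tau_mem_stage_zero : (2 * (Real.pi : ℂ) * Complex.I) ∈ stage 0 := two_pi_I_mem_stage_zero

/-- Elements of the `ℚ`-span of a subset of an intermediate field lie in the field. [folklore] -/
theorem mem_of_mem_span {L : IntermediateField ℚ ℂ} {T : Set ℂ} (hT : T ⊆ L) {a : ℂ}
    (ha : a ∈ Submodule.span ℚ T) : a ∈ L := by
  induction ha using Submodule.span_induction with
  | mem b hb => exact hT hb
  | zero => exact zero_mem L
  | add b c _ _ hb hc => exact add_mem hb hc
  | smul q b _ hb => exact L.smul_mem hb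

/-- `2πi` is transcendental (tree `transcendental_two_pi_I`, Lindemann). [folklore] -/
theorem transcendental_tau : Transcendental ℚ (2 * (Real.pi : ℂ) * Complex.I) := transcendental_two_pi_I

/-- `e^{a}` is algebraic for every `a ∈ ℚ·2πi` (a root of unity). [folklore] -/
theorem isAlgebraic_exp_of_mem_span_tau {a : ℂ} (ha : a ∈ Submodule.span ℚ ({(2 * (Real.pi : ℂ) * Complex.I)} : Set ℂ)) :
    IsAlgebraic ℚ (Complex.exp a) := by
  refine Literature.NumberTheory.Transcendental.isAlgebraic_exp_of_mem_span
    (Submodule.span_mono ?_ ha)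
  intro b hb
  rw [Set.mem_singleton_iff.mp hb]
  show IsAlgebraic ℚ (Complex.exp (2 * ↑Real.pi * Complex.I))
  rw [Complex.exp_two_pi_mul_I]
  exact isAlgebraic_one

/-- **Inside the kernel line**: a `ℚ`-linearly independent tuple inside `ℚ·2πi` has length `≤ 1`
and `trdeg ℚ(q·2πi, e^{q·2πi}) = 1` (`π` transcendental). [cite: Lindemann1882] -/
theorem insideKernelLine :
    ∀ (k : ℕ) (y : Fin k → ℂ), (∀ i, y i ∈ Submodule.span ℚ ({(2 * (Real.pi : ℂ) * Complex.I)} : Set ℂ)) →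
      LinearIndependent ℚ y →
        (k : Cardinal) ≤ Algebra.trdeg ℚ ↥(adjoin ℚ (Set.range y ∪ Set.range (Complex.exp ∘ y))) := by
  intro k y hy hli
  -- `k ≤ 1`
  set P : Submodule ℚ ℂ := Submodule.span ℚ ({(2 * (Real.pi : ℂ) * Complex.I)} : Set ℂ) with hP
  let y' : Fin k → P := fun i => ⟨y i, hy i⟩
  have hli' : LinearIndependent ℚ y' := LinearIndependent.of_comp P.subtype (by exact hli)
  have hk : k ≤ 1 := by
    have h1 := hli'.fintype_card_le_finrank
    rw [Fintype.card_fin] at h1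
    exact h1.trans ((finrank_span_le_card ({(2 * (Real.pi : ℂ) * Complex.I)} : Set ℂ)).trans (by simp))
  interval_cases k
  · simp
  · have hy0 : y 0 ≠ 0 := hli.ne_zero 0
    have hyt : Transcendental ℚ (y 0) := by
      obtain ⟨c, hc⟩ := Submodule.mem_span_singleton.mp (hy 0)
      intro halg
      have hc0 : c ≠ 0 := by rintro rfl; exact hy0 (by rw [← hc, zero_smul])
      apply transcendental_tau
      have : (2 * (Real.pi : ℂ) * Complex.I) = c⁻¹ • y 0 := by rw [← hc, smul_smul, inv_mul_cancel₀ hc0, one_smul]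
      rw [this, Rat.smul_def]
      exact (isAlgebraic_algebraMap (c⁻¹ : ℚ)).mul halg
    have hmem : y 0 ∈ adjoin ℚ (Set.range y ∪ Set.range (Complex.exp ∘ y)) :=
      subset_adjoin ℚ _ (Or.inl ⟨0, rfl⟩)
    simpa using Literature.Barriers.Schanuel.one_le_trdeg_of_transcendental_mem hmem hyt

/-! ## Glue, part 2: the sector split at a `ℚ`-subspace (Kirby's `GL_n(ℚ)` bookkeeping) -/

open Submodule in
/-- **Sector split** (the tree's `schanuel_of_sector_split_set` / Kirby 2010 Prop. 7.2
bookkeeping, in RELATIVE-LW form). Let `S ⊆ L` with `e^{span S} ⊆ L`. If (inside) Schanuel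
holds for `ℚ`-linearly independent tuples from `span_ℚ S`, and (outside) exponentials of
tuples from `L` that are `ℚ`-linearly independent modulo `span_ℚ S` are algebraically
independent over `L`, then Schanuel holds for all `ℚ`-linearly independent tuples from `L`.
Proof: `V = span x̄`, `W = V ⊓ span S`, `U` a complement, bases `y` of `W`, `z` of `U` cleared of
denominators (so `y, z, e^y, e^z ∈ ℚ(x̄, e^{x̄})`); `k ≤ trdeg ℚ(y, e^y)` (inside);
`e^z` algebraically independent over `L ⊇ ℚ(y, e^y, z)` (outside), so
`m ≤ trdeg_{ℚ(y,e^y,z)} ℚ(y, e^y, z)(e^z)`; the tower law gives `k + m = n ≤ trdeg ℚ(y, e^y, z, e^z)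
≤ trdeg ℚ(x̄, e^{x̄})`. [cite: Kirby2010, Prop. 7.2] -/
theorem sectorSplit (S : Set ℂ) (L : IntermediateField ℚ ℂ) (hSL : S ⊆ L)
    (hexpS : ∀ a ∈ Submodule.span ℚ S, Complex.exp a ∈ L)
    (hIn : ∀ (k : ℕ) (y : Fin k → ℂ), (∀ i, y i ∈ Submodule.span ℚ S) → LinearIndependent ℚ y →
      (k : Cardinal) ≤ Algebra.trdeg ℚ ↥(adjoin ℚ (Set.range y ∪ Set.range (Complex.exp ∘ y))))
    (hOut : ∀ (m : ℕ) (z : Fin m → ℂ), (∀ j, z j ∈ L) →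
      LinearIndependent ℚ ((Submodule.span ℚ S).mkQ ∘ z) →
        AlgebraicIndependent (↥L) (fun j => Complex.exp (z j))) :
    ∀ (n : ℕ) (x : Fin n → ℂ), (∀ i, x i ∈ L) → LinearIndependent ℚ x →
      (n : Cardinal) ≤ Algebra.trdeg ℚ ↥(adjoin ℚ (Set.range x ∪ Set.range (Complex.exp ∘ x))) := by
  intro n x hxL hx
  set Eq : Submodule ℚ ℂ := span ℚ S with hEqdef
  -- the `ℚ`-span `V` of `x̄`, `W = V ∩ E` and a complement `U` of `W` in `V`
  set V : Submodule ℚ ℂ := span ℚ (Set.range x) with hV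
  haveI : FiniteDimensional ℚ V := FiniteDimensional.span_of_finite ℚ (Set.finite_range x)
  set W : Submodule ℚ ℂ := V ⊓ Eq with hW
  obtain ⟨U', hU'⟩ := W.exists_isCompl
  set U : Submodule ℚ ℂ := V ⊓ U' with hU
  haveI : FiniteDimensional ℚ W := Submodule.finiteDimensional_of_le inf_le_left
  haveI : FiniteDimensional ℚ U := Submodule.finiteDimensional_of_le inf_le_left
  have hWU_sup : W ⊔ U = V := by
    rw [hU, inf_comm, ← sup_inf_assoc_of_le U' (inf_le_left : W ≤ V), hU'.sup_eq_top, top_inf_eq]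
  have hWU_disj : Disjoint W U := hU'.disjoint.mono_right inf_le_right
  have hUE_disj : Disjoint U Eq := by
    rw [disjoint_def]
    intro a haU haE
    exact (disjoint_def.mp hWU_disj) a ⟨inf_le_left (b := U') haU, haE⟩ haU
  -- `V ⊆ L`
  have hVL : ∀ a ∈ V, a ∈ L := fun a ha =>
    mem_of_mem_span (L := L) (T := Set.range x) (Set.range_subset_iff.mpr hxL) ha
  -- dimensions
  set k := Module.finrank ℚ W
  set m := Module.finrank ℚ U
  have hn : k + m = n := by
    have h1 := Submodule.finrank_sup_add_finrank_inf_eq W U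
    rw [hWU_disj.eq_bot, finrank_bot, add_zero, hWU_sup] at h1
    rw [← h1, hV, finrank_span_eq_card hx, Fintype.card_fin]
  -- bases
  let bW := Module.finBasis ℚ W
  let bU := Module.finBasis ℚ U
  let y : Fin k → ℂ := fun i => (bW i : ℂ)
  let z : Fin m → ℂ := fun j => (bU j : ℂ)
  have hy_mem : ∀ i, y i ∈ Eq := fun i => ((bW i).2 : (bW i : ℂ) ∈ V ⊓ Eq).2
  have hy_V : ∀ i, y i ∈ V := fun i => ((bW i).2 : (bW i : ℂ) ∈ V ⊓ Eq).1
  have hz_U : ∀ j, z j ∈ U := fun j => (bU j).2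
  have hz_V : ∀ j, z j ∈ V := fun j => inf_le_left (b := U') (hz_U j)
  have hy_li : LinearIndependent ℚ y := bW.linearIndependent.map' W.subtype W.ker_subtype
  have hz_li : LinearIndependent ℚ z := bU.linearIndependent.map' U.subtype U.ker_subtype
  -- clearing denominators
  choose Ny hNy hNy_mem using fun i =>
    Literature.NumberTheory.Transcendental.exists_nsmul_mem_span_int x (hy_V i)
  choose Nz hNz hNz_mem using fun j =>
    Literature.NumberTheory.Transcendental.exists_nsmul_mem_span_int x (hz_V j)
  let cy : Fin k → ℚˣ := fun i => Units.mk0 (Ny i : ℚ) (Nat.cast_ne_zero.mpr (hNy i))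
  let cz : Fin m → ℚˣ := fun j => Units.mk0 (Nz j : ℚ) (Nat.cast_ne_zero.mpr (hNz j))
  let y' : Fin k → ℂ := fun i => (Ny i : ℚ) • y i
  let z' : Fin m → ℂ := fun j => (Nz j : ℚ) • z j
  have hy'_eq : cy • y = y' := by
    funext i; simp only [Pi.smul_apply', cy, y', Units.smul_def, Units.val_mk0]
  have hz'_eq : cz • z = z' := by
    funext j; simp only [Pi.smul_apply', cz, z', Units.smul_def, Units.val_mk0]
  have hy'_li : LinearIndependent ℚ y' := hy'_eq ▸ hy_li.units_smul cy
  have hz'_li : LinearIndependent ℚ z' := hz'_eq ▸ hz_li.units_smul cz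
  have hy'_mem : ∀ i, y' i ∈ Eq := fun i => Eq.smul_mem _ (hy_mem i)
  have hz'_U : ∀ j, z' j ∈ U := fun j => U.smul_mem _ (hz_U j)
  have hz'_L : ∀ j, z' j ∈ L := fun j => hVL _ (inf_le_left (b := U') (hz'_U j))
  have hz'_modE : LinearIndependent ℚ ((span ℚ S).mkQ ∘ z') := by
    refine hz'_li.map ?_
    rw [ker_mkQ]
    exact hUE_disj.mono_left (span_le.mpr (Set.range_subset_iff.mpr hz'_U))
  -- the field-theoretic estimate
  set Sy := Set.range y' ∪ Set.range (Complex.exp ∘ y') with hSy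
  set Tz := Set.range (Complex.exp ∘ z') with hTz
  set Ky := adjoin ℚ Sy with hKy
  set K' := adjoin ℚ (Sy ∪ Set.range z') with hK'
  have hk : (k : Cardinal) ≤ Algebra.trdeg ℚ Ky := hIn k y' hy'_mem hy'_li
  have hKyK' : Ky ≤ K' := adjoin.mono ℚ _ _ Set.subset_union_left
  have hk' : (k : Cardinal) ≤ Algebra.trdeg ℚ K' :=
    hk.trans (Literature.Barriers.Schanuel.trdeg_mono hKyK')
  have hK'L : K' ≤ L := by
    rw [hK', adjoin_le_iff]
    rintro a ((⟨i, rfl⟩ | ⟨i, rfl⟩) | ⟨j, rfl⟩)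
    · exact mem_of_mem_span (L := L) hSL (hy'_mem i)
    · exact hexpS _ (hy'_mem i)
    · exact hz'_L j
  have halg : AlgebraicIndependent (↥L) (fun j => Complex.exp (z' j)) := hOut m z' hz'_L hz'_modE
  have halg' : AlgebraicIndependent (↥K') (fun j => Complex.exp (z' j)) :=
    Literature.NumberTheory.Transcendental.AlgebraicIndependent.of_intermediateField_le hK'L halg
  have hm : (m : Cardinal) ≤ Algebra.trdeg (↥K') ↥(adjoin (↥K') Tz) := by
    let f : Fin m → ↥(adjoin (↥K') Tz) :=
      fun j => ⟨Complex.exp (z' j), subset_adjoin (↥K') Tz ⟨j, rfl⟩⟩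
    have hf : AlgebraicIndependent (↥K') f :=
      AlgebraicIndependent.of_comp (adjoin (↥K') Tz).val halg'
    simpa using hf.cardinalMk_le_trdeg
  have hkm : (k : Cardinal) + m ≤ Algebra.trdeg ℚ (adjoin ℚ ((Sy ∪ Set.range z') ∪ Tz)) :=
    Literature.NumberTheory.Transcendental.add_le_trdeg_adjoin_union _ Tz hk' hm
  -- comparison with `ℚ(x̄, e^{x̄})`
  set Kx := adjoin ℚ (Set.range x ∪ Set.range (Complex.exp ∘ x)) with hKx
  have hle : adjoin ℚ ((Sy ∪ Set.range z') ∪ Tz) ≤ Kx := by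
    rw [adjoin_le_iff]
    rintro a (((⟨i, rfl⟩ | ⟨i, rfl⟩) | ⟨j, rfl⟩) | ⟨j, rfl⟩)
    · exact (Literature.NumberTheory.Transcendental.mem_adjoin_of_mem_span_int x (hNy_mem i)).1
    · exact (Literature.NumberTheory.Transcendental.mem_adjoin_of_mem_span_int x (hNy_mem i)).2
    · exact (Literature.NumberTheory.Transcendental.mem_adjoin_of_mem_span_int x (hNz_mem j)).1
    · exact (Literature.NumberTheory.Transcendental.mem_adjoin_of_mem_span_int x (hNz_mem j)).2
  have hfin : Algebra.trdeg ℚ (adjoin ℚ ((Sy ∪ Set.range z') ∪ Tz)) ≤ Algebra.trdeg ℚ Kx :=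
    Literature.Barriers.Schanuel.trdeg_mono hle
  calc (n : Cardinal) = (k : Cardinal) + m := by rw [← hn, Nat.cast_add]
    _ ≤ Algebra.trdeg ℚ (adjoin ℚ ((Sy ∪ Set.range z') ∪ Tz)) := hkm
    _ ≤ Algebra.trdeg ℚ Kx := hfin

/-! ## Glue, part 3: the induction up the tower and the crux -/

/-- `e^{a} ∈ L₀` for `a ∈ ℚ·2πi`. [folklore] -/
theorem exp_mem_stage_zero_of_mem_span_tau {a : ℂ} (ha : a ∈ Submodule.span ℚ ({(2 * (Real.pi : ℂ) * Complex.I)} : Set ℂ)) :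
    Complex.exp a ∈ stage 0 :=
  mem_relAlg_of_isAlgebraic _ (isAlgebraic_exp_of_mem_span_tau ha)

/-- **Tower reduction, level by level**: `RelLW₀` and `RelLW_{m+1}` (all `m`) give Schanuel's
statement on every level `L_m` — induction on `m` through `sectorSplit`, the base split being at
the kernel line `ℚ·2πi` (`insideKernelLine`). [cite: Kirby2010, Prop. 7.2] -/
theorem schanuelOn_stage
    (h0 : ∀ (r : ℕ) (u : Fin r → ℂ), (∀ i, u i ∈ stage 0) →
      LinearIndependent ℚ ((Submodule.span ℚ ({(2 * (Real.pi : ℂ) * Complex.I)} : Set ℂ)).mkQ ∘ u) →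
        AlgebraicIndependent (↥(stage 0)) (fun i => Complex.exp (u i)))
    (hS : ∀ (m r : ℕ) (u : Fin r → ℂ), (∀ i, u i ∈ stage (m + 1)) →
      LinearIndependent ℚ ((Submodule.span ℚ (stage m : Set ℂ)).mkQ ∘ u) →
        AlgebraicIndependent (↥(stage (m + 1))) (fun i => Complex.exp (u i))) :
    ∀ (m n : ℕ) (x : Fin n → ℂ), (∀ i, x i ∈ stage m) → LinearIndependent ℚ x →
      (n : Cardinal) ≤ Algebra.trdeg ℚ ↥(adjoin ℚ (Set.range x ∪ Set.range (Complex.exp ∘ x)))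
  | 0 =>
    sectorSplit {(2 * (Real.pi : ℂ) * Complex.I)} (stage 0) (Set.singleton_subset_iff.mpr tau_mem_stage_zero)
      (fun _ ha => exp_mem_stage_zero_of_mem_span_tau ha) insideKernelLine h0
  | m + 1 =>
    sectorSplit (stage m : Set ℂ) (stage (m + 1)) (stage_le_succ m)
      (fun _ ha => exp_mem_stage_succ (mem_of_mem_span (L := stage m) subset_rfl ha))
      (fun k y hy hli => schanuelOn_stage h0 hS m k y
        (fun i => mem_of_mem_span (L := stage m) subset_rfl (hy i)) hli)
      (hS m)

/-- **Tower reduction**: with the exhaustion `C_EA ⊆ ⋃ₘ L_m`, a tuple from the core sits in one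
level `L_M` (the tower is monotone), where `schanuelOn_stage` applies. [folklore] -/
theorem towerReduction
    (h0 : ∀ (r : ℕ) (u : Fin r → ℂ), (∀ i, u i ∈ stage 0) →
      LinearIndependent ℚ ((Submodule.span ℚ ({(2 * (Real.pi : ℂ) * Complex.I)} : Set ℂ)).mkQ ∘ u) →
        AlgebraicIndependent (↥(stage 0)) (fun i => Complex.exp (u i)))
    (hS : ∀ (m r : ℕ) (u : Fin r → ℂ), (∀ i, u i ∈ stage (m + 1)) →
      LinearIndependent ℚ ((Submodule.span ℚ (stage m : Set ℂ)).mkQ ∘ u) →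
        AlgebraicIndependent (↥(stage (m + 1))) (fun i => Complex.exp (u i)))
    (hE : ∀ a : ℂ, a ∈ logFreeCore → ∃ m : ℕ, a ∈ stage m) :
    ∀ (n : ℕ) (x : Fin n → ℂ), (∀ i, x i ∈ logFreeCore) → LinearIndependent ℚ x →
      (n : Cardinal) ≤ Algebra.trdeg ℚ ↥(adjoin ℚ (Set.range x ∪ Set.range (Complex.exp ∘ x))) := by
  intro n x hx hli
  choose lvl hlvl using fun i => hE (x i) (hx i)
  exact schanuelOn_stage h0 hS (Finset.univ.sup lvl) n x
    (fun i => monotone_stage (Finset.le_sup (Finset.mem_univ i)) (hlvl i)) hli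

/-- A singleton `(a)` with `a ∉ ℚ·2πi` is `ℚ`-linearly independent modulo the kernel line. [folklore] -/
theorem linearIndependent_mkQ_singleton {a : ℂ}
    (ha : a ∉ Submodule.span ℚ ({(2 * ↑Real.pi * Complex.I : ℂ)} : Set ℂ)) :
    LinearIndependent ℚ
      ((Submodule.span ℚ ({(2 * ↑Real.pi * Complex.I : ℂ)} : Set ℂ)).mkQ ∘ fun _ : Fin 1 => a) := by
  rw [linearIndependent_unique_iff]
  simpa [Submodule.Quotient.mk_eq_zero] using ha

/-! ## Level 0 isolated: `RelLW₀ ⟺` Schanuel over `ℚ(π)^{ralg}`; the `r = 1` layer -/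

/-- **`RelLW₀ ⟹` Schanuel's statement for tuples from `L₀ = stage 0`** (the level-0 sector split
at the kernel line; the hypothesis is the line's open layer RelLW₀). With the landed converse
`stub_relLWZero_of_schanuelOnStageZero` (`…RelLWZeroOfStageZero.lean`): `RelLW₀ ⟺ SC|_{L₀}`.
[cite: Kirby2010, Prop. 7.2] -/
theorem schanuelOnStageZero_of_relLWZero
    (h0 : ∀ (r : ℕ) (u : Fin r → ℂ), (∀ i, u i ∈ stage 0) →
      LinearIndependent ℚ ((Submodule.span ℚ ({(2 * (Real.pi : ℂ) * Complex.I)} : Set ℂ)).mkQ ∘ u) →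
        AlgebraicIndependent (↥(stage 0)) (fun i => Complex.exp (u i))) :
    ∀ (n : ℕ) (x : Fin n → ℂ), (∀ i, x i ∈ stage 0) → LinearIndependent ℚ x →
      (n : Cardinal) ≤ Algebra.trdeg ℚ ↥(adjoin ℚ (Set.range x ∪ Set.range (Complex.exp ∘ x))) :=
  sectorSplit {(2 * (Real.pi : ℂ) * Complex.I)} (stage 0) (Set.singleton_subset_iff.mpr tau_mem_stage_zero)
    (fun _ ha => exp_mem_stage_zero_of_mem_span_tau ha) insideKernelLine h0

/-- Over the relatively algebraically closed `L₀`, "transcendental over `L₀`" is "not in `L₀`". [folklore] -/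
theorem transcendental_stage_zero_iff {y : ℂ} : Transcendental (↥(stage 0)) y ↔ y ∉ stage 0 :=
  ⟨fun ht hy => ht (isAlgebraic_algebraMap (⟨y, hy⟩ : ↥(stage 0))),
    fun hy ha => hy (stage_closed 0 y ha)⟩

/-- **The `r = 1` layer of `RelLW₀`, three ways.** Stub 1 at `r = 1` ⟺ "for `a ∈ L₀ ∖ ℚ·2πi`,
`e^a` is transcendental over `L₀`" ⟺ "the elements of `L₀ = ℚ(π)^{ralg}` whose exponential lies
again in `L₀` are exactly the rational multiples of `2πi`" (`exp(L₀) ∩ L₀ ⊆ μ_∞`-type statement).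
Settled instances (tree): `a = cπ` (Nesterenko, `…RelLWZeroRatPi.lean`), `a` algebraic off the
axes (LW + conjugation, `…RelLWZeroOffAxes.lean`), at most one `ℚ`-line of algebraic exceptions
(`…ExpExceptionalLine.lean`), six-exponentials disjunctions (`…SixExpStageZero.lean`); open:
`a = 1` (`e ⊥ π`), `a = i`, `a = π²`, `a = √2`, `a = iπ√2`. [folklore] -/
theorem relLWZero_one_iff :
    ((∀ (u : Fin 1 → ℂ), (∀ i, u i ∈ stage 0) →
        LinearIndependent ℚ
          ((Submodule.span ℚ ({(2 * ↑Real.pi * Complex.I : ℂ)} : Set ℂ)).mkQ ∘ u) →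
          AlgebraicIndependent (↥(stage 0)) (fun i => Complex.exp (u i))) ↔
      ∀ a : ℂ, a ∈ stage 0 → a ∉ Submodule.span ℚ ({(2 * ↑Real.pi * Complex.I : ℂ)} : Set ℂ) →
        Transcendental (↥(stage 0)) (Complex.exp a)) ∧
    ((∀ a : ℂ, a ∈ stage 0 → a ∉ Submodule.span ℚ ({(2 * ↑Real.pi * Complex.I : ℂ)} : Set ℂ) →
        Transcendental (↥(stage 0)) (Complex.exp a)) ↔
      ∀ a : ℂ, a ∈ stage 0 → Complex.exp a ∈ stage 0 →
        a ∈ Submodule.span ℚ ({(2 * ↑Real.pi * Complex.I : ℂ)} : Set ℂ)) := by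
  set P : Submodule ℚ ℂ := Submodule.span ℚ ({(2 * ↑Real.pi * Complex.I : ℂ)} : Set ℂ) with hP
  refine ⟨⟨fun h a ha hna => ?_, fun h u hu hli => ?_⟩, ⟨fun h a ha hea => ?_, fun h a ha hna => ?_⟩⟩
  · have h1 : AlgebraicIndependent (↥(stage 0)) (fun _ : Fin 1 => Complex.exp a) :=
      h (fun _ => a) (fun _ => ha) (linearIndependent_mkQ_singleton hna)
    exact (algebraicIndependent_singleton_iff (0 : Fin 1)).mp h1
  · have hli' : u 0 ∉ P := by
      intro hmem
      have h0 : (P.mkQ ∘ u) 0 = 0 := by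
        simp only [Function.comp_apply, Submodule.mkQ_apply, Submodule.Quotient.mk_eq_zero]
        exact hmem
      exact (linearIndependent_unique_iff (v := P.mkQ ∘ u)).mp hli h0
    have hu0 : (fun i => Complex.exp (u i)) = fun _ : Fin 1 => Complex.exp (u 0) :=
      funext fun i => by rw [Subsingleton.elim i 0]
    rw [hu0]
    exact (algebraicIndependent_singleton_iff (0 : Fin 1)).mpr (h (u 0) (hu 0) hli')
  · by_contra hna
    exact (transcendental_stage_zero_iff.mp (h a ha hna)) hea
  · exact transcendental_stage_zero_iff.mpr fun hea => hna (h a ha hea)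

end KernelTower

/-- **The kernel-tower reduction of the crux**: the two RELATIVE LINDEMANN–WEIERSTRASS layers of the
line — `RelLW₀` (exponentials of elements of `L₀ = ℚ(2πi)^{ralg}` independent modulo `ℚ·2πi` are
algebraically independent over `L₀`) and `RelLW_{m+1}` for all `m` (the same one level up the tower
`stage`) — imply the crux `RigidCore.SchanuelOnLogFreeCore` BY NAME (exhaustion `C_EA = ⋃ₘ stage m`
is the tree theorem `mem_logFreeCore_iff_exists_stage`). Both layers are OPEN; the converse
implications are the landed `stub_relLWZero_of_crux`, `stub_relLWStep_of_crux`, so this normal form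
of (R) is exact. [cite: Kirby2010, Prop. 7.2] -/
theorem stub_towerReduction :
    (∀ (r : ℕ) (u : Fin r → ℂ), (∀ i, u i ∈ stage 0) →
      LinearIndependent ℚ ((Submodule.span ℚ ({(2 * ↑Real.pi * Complex.I : ℂ)} : Set ℂ)).mkQ ∘ u) →
        AlgebraicIndependent (↥(stage 0)) (fun i => Complex.exp (u i))) →
    (∀ (m r : ℕ) (u : Fin r → ℂ), (∀ i, u i ∈ stage (m + 1)) →
      LinearIndependent ℚ ((Submodule.span ℚ (stage m : Set ℂ)).mkQ ∘ u) →
        AlgebraicIndependent (↥(stage (m + 1))) (fun i => Complex.exp (u i))) →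
    Summit.Schanuel.Schanuel.Theses.RigidCore.SchanuelOnLogFreeCore :=
  fun h0 hS => KernelTower.towerReduction h0 hS fun _ ha => mem_logFreeCore_iff_exists_stage.mp ha

end Summit.Schanuel.Schanuel.Theorems.RigidCore

end
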